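import Summits.CriticalPhenomena.PercolationContinuityZ3.Theorems.Transplant.FKConnectivityAllQAntipodalRootFormGen
import Summits.CriticalPhenomena.PercolationContinuityZ3.Theorems.Transplant.FKConnectivityAllQAntipodalRootFormWords

/-!
# Connectivity correlation inequalities for `φ_{w,q}`, every `q > 0` — ROOT-FORM CALCULUS FOR ANY NUMBER OF SPECIALS, file 61β:
# (PQ), the closure of the AND facts, and the WORD THEOREM for pattern-indexed environments

Support file (`--supports stmt-CriticalPhenomena-4575`), FK sub-lane `prim-bschramm-fk-2` (gen 29); builds on p205010 (kernel theorem,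
internal audit signed; external expert review pending).  Standard axioms, no sorries.  Memo FROM-fk-2-g29-BRIDGE.md §7–§8.

Verbatim port of file 61b (`gMt_par_par_nonneg`, `gandDel/gandCon/andFree_{ser,par}_nonneg`) and of file 61c (`spine`, `gspine_facts`,
`gspine_root_nonneg`) to the pattern-indexed data `Gen.EDat ι` of file 61α: the five facts (nested root functional, its parallel transform,
deleted / contracted / free-nested AND) propagate from any base environment to every spine environment `ℓ₁(⋯ℓ_m(E)⋯)`, for environments
with ANY number of specials — the induction engine of the threshold family `ω_x·OR(ω_T) ∨ AND(ω_T)`. [folklore]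
-/

noncomputable section

namespace Summit.CriticalPhenomena.PercolationContinuityZ3.Theorems

namespace FK

namespace RootForm

namespace Gen

open Finset

variable {ι : Type*} [Fintype ι] [DecidableEq ι]

section Steps

variable {C : Type*} [Fintype C] [Preorder C]

/-- **(PQ) transfers nonnegativity**: `M̃_{g∥(g'∥𝓔)} ≥ 0` from `M̃_{g'∥𝓔} ≥ 0` (diagonal sections) and the contracted AND of `𝓔`
(mixed sections). [folklore] -/
theorem gMt_par_par_nonneg {E : Env ι C}
    (hP : ∀ h0 h1 : Bool × C → ℝ, Monotone h0 → Monotone h1 → (∀ p, 0 ≤ h0 p) → (∀ p, h0 p ≤ h1 p) → ∀ J : ℤ,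
      0 ≤ gMt (parE E) h0 h1 J)
    (hc : ∀ h : C → ℝ, Monotone h → (∀ γ, 0 ≤ h γ) → ∀ J : ℤ, 0 ≤ ∑ γ, h γ * (E γ).gandCon J)
    {H0 H1 : Bool × (Bool × C) → ℝ} (m0 : Monotone H0) (m1 : Monotone H1) (n0 : ∀ p, 0 ≤ H0 p) (le : ∀ p, H0 p ≤ H1 p)
    (J : ℤ) : 0 ≤ gMt (parE (parE E)) H0 H1 J := by
  have key : gMt (parE (parE E)) H0 H1 J =
      gMt (parE E) (fun p => H0 (p.1, p.1, p.2)) (fun p => H1 (p.1, p.1, p.2)) (J - 1)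
      + ∑ γ, (H1 (true, false, γ) + H0 (true, false, γ)) * (E γ).gandCon (J - 1)
      + ∑ γ, (H1 (false, true, γ) + H0 (false, true, γ)) * (E γ).gandCon (J - 1)
      + ∑ γ, ((H1 (true, false, γ) - H0 (true, false, γ)) + (H1 (false, true, γ) - H0 (false, true, γ))) * (E γ).grconE J := by
    unfold gMt; rw [sum_bool_prod, sum_bool_prod, sum_bool_prod, sum_bool_prod]
    have e1 : ∀ γ, (parE (parE E) (true, false, γ)) = ((E γ).par false).par (!false) := fun γ => rfl
    have e2 : ∀ γ, (parE (parE E) (false, true, γ)) = ((E γ).par true).par (!true) := fun γ => rfl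
    simp only [e1, e2, EDat.gslot1_par_par_mixed, EDat.gslot0_par_par_mixed]
    simp only [parE, EDat.gslot1_par_par_same, EDat.gslot0_par_par_same]
    simp only [← Finset.sum_add_distrib]
    exact Finset.sum_congr rfl fun γ _ => by ring
  rw [key]
  have hd0 : Monotone fun p : Bool × C => H0 (p.1, p.1, p.2) := mono_diag m0
  have hd1 : Monotone fun p : Bool × C => H1 (p.1, p.1, p.2) := mono_diag m1
  refine add_nonneg (add_nonneg (add_nonneg (hP _ _ hd0 hd1 (fun p => n0 _) (fun p => le _) _) ?_) ?_) ?_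
  · exact hc _ ((mono_sec (mono_sec m1 true) false).add (mono_sec (mono_sec m0 true) false))
      (fun γ => add_nonneg ((n0 _).trans (le _)) (n0 _)) _
  · exact hc _ ((mono_sec (mono_sec m1 false) true).add (mono_sec (mono_sec m0 false) true))
      (fun γ => add_nonneg ((n0 _).trans (le _)) (n0 _)) _
  · exact Finset.sum_nonneg fun γ _ => mul_nonneg (add_nonneg (sub_nonneg.2 (le _)) (sub_nonneg.2 (le _))) ((E γ).grconE_nonneg J)

/-- The deleted AND of `f·𝓔` from the deleted AND of `𝓔`. [folklore] -/
theorem gandDel_ser_nonneg {E : Env ι C}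
    (hd : ∀ h : C → ℝ, Monotone h → (∀ γ, 0 ≤ h γ) → ∀ J : ℤ, 0 ≤ ∑ γ, h γ * (E γ).gandDel J)
    {H : Bool × C → ℝ} (m : Monotone H) (n : ∀ p, 0 ≤ H p) (J : ℤ) : 0 ≤ ∑ p, H p * (serE E p).gandDel J := by
  rw [sum_bool_prod]; simp only [serE, EDat.gandDel_ser]
  exact add_nonneg (hd _ (mono_sec m true) (fun γ => n _) J) (hd _ (mono_sec m false) (fun γ => n _) J)

/-- The deleted AND of `g∥𝓔` from the free nested AND of `𝓔`. [folklore] -/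
theorem gandDel_par_nonneg {E : Env ι C}
    (hf : ∀ h0 h1 : C → ℝ, Monotone h0 → Monotone h1 → (∀ γ, 0 ≤ h0 γ) → (∀ γ, h0 γ ≤ h1 γ) → ∀ J : ℤ,
      0 ≤ ∑ γ, (h1 γ * (E γ).gandE1 J + h0 γ * (E γ).gandE2 J))
    {H : Bool × C → ℝ} (m : Monotone H) (n : ∀ p, 0 ≤ H p) (J : ℤ) : 0 ≤ ∑ p, H p * (parE E p).gandDel J := by
  rw [sum_bool_prod]; simp only [parE, EDat.gandDel_par_true, EDat.gandDel_par_false]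
  rw [← Finset.sum_add_distrib]
  exact hf _ _ (mono_sec m false) (mono_sec m true) (fun γ => n _) (fun γ => sec_le m γ) J

/-- The contracted AND of `f·𝓔` from the free nested AND of `𝓔`. [folklore] -/
theorem gandCon_ser_nonneg {E : Env ι C}
    (hf : ∀ h0 h1 : C → ℝ, Monotone h0 → Monotone h1 → (∀ γ, 0 ≤ h0 γ) → (∀ γ, h0 γ ≤ h1 γ) → ∀ J : ℤ,
      0 ≤ ∑ γ, (h1 γ * (E γ).gandE1 J + h0 γ * (E γ).gandE2 J))
    {H : Bool × C → ℝ} (m : Monotone H) (n : ∀ p, 0 ≤ H p) (J : ℤ) : 0 ≤ ∑ p, H p * (serE E p).gandCon J := by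
  rw [sum_bool_prod]; simp only [serE, EDat.gandCon_ser_true, EDat.gandCon_ser_false]
  rw [← Finset.sum_add_distrib]
  exact hf _ _ (mono_sec m false) (mono_sec m true) (fun γ => n _) (fun γ => sec_le m γ) J

/-- The contracted AND of `g∥𝓔` from the contracted AND of `𝓔`. [folklore] -/
theorem gandCon_par_nonneg {E : Env ι C}
    (hc : ∀ h : C → ℝ, Monotone h → (∀ γ, 0 ≤ h γ) → ∀ J : ℤ, 0 ≤ ∑ γ, h γ * (E γ).gandCon J)
    {H : Bool × C → ℝ} (m : Monotone H) (n : ∀ p, 0 ≤ H p) (J : ℤ) : 0 ≤ ∑ p, H p * (parE E p).gandCon J := by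
  rw [sum_bool_prod]; simp only [parE, EDat.gandCon_par]
  exact add_nonneg (hc _ (mono_sec m true) (fun γ => n _) _) (hc _ (mono_sec m false) (fun γ => n _) _)

/-- The free nested AND of `f·𝓔` from the free nested AND and the deleted AND of `𝓔`. [folklore] -/
theorem gandFree_ser_nonneg {E : Env ι C}
    (hf : ∀ h0 h1 : C → ℝ, Monotone h0 → Monotone h1 → (∀ γ, 0 ≤ h0 γ) → (∀ γ, h0 γ ≤ h1 γ) → ∀ J : ℤ,
      0 ≤ ∑ γ, (h1 γ * (E γ).gandE1 J + h0 γ * (E γ).gandE2 J))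
    (hd : ∀ h : C → ℝ, Monotone h → (∀ γ, 0 ≤ h γ) → ∀ J : ℤ, 0 ≤ ∑ γ, h γ * (E γ).gandDel J)
    {H0 H1 : Bool × C → ℝ} (m0 : Monotone H0) (m1 : Monotone H1) (n0 : ∀ p, 0 ≤ H0 p) (le : ∀ p, H0 p ≤ H1 p) (J : ℤ) :
    0 ≤ ∑ p, (H1 p * (serE E p).gandE1 J + H0 p * (serE E p).gandE2 J) := by
  rw [sum_bool_prod]
  simp only [serE, EDat.gandE1_ser_true, EDat.gandE1_ser_false, EDat.gandE2_ser_true, EDat.gandE2_ser_false]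
  have : ∑ γ, (H1 (true, γ) * (E γ).gandE1 J + H0 (true, γ) * (E γ).gandDel J)
      + ∑ γ, (H1 (false, γ) * (E γ).gandDel J + H0 (false, γ) * (E γ).gandE2 J)
      = ∑ γ, (H1 (true, γ) * (E γ).gandE1 J + H0 (false, γ) * (E γ).gandE2 J)
        + ∑ γ, H0 (true, γ) * (E γ).gandDel J + ∑ γ, H1 (false, γ) * (E γ).gandDel J := by
    rw [← Finset.sum_add_distrib, ← Finset.sum_add_distrib, ← Finset.sum_add_distrib]
    exact Finset.sum_congr rfl fun γ _ => by ring
  rw [this]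
  exact add_nonneg (add_nonneg (hf _ _ (mono_sec m0 false) (mono_sec m1 true) (fun γ => n0 _)
    (fun γ => (sec_le m0 γ).trans (le _)) J) (hd _ (mono_sec m0 true) (fun γ => n0 _) J))
    (hd _ (mono_sec m1 false) (fun γ => (n0 _).trans (le _)) J)

/-- The free nested AND of `g∥𝓔` from the free nested AND and the contracted AND of `𝓔`. [folklore] -/
theorem gandFree_par_nonneg {E : Env ι C}
    (hf : ∀ h0 h1 : C → ℝ, Monotone h0 → Monotone h1 → (∀ γ, 0 ≤ h0 γ) → (∀ γ, h0 γ ≤ h1 γ) → ∀ J : ℤ,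
      0 ≤ ∑ γ, (h1 γ * (E γ).gandE1 J + h0 γ * (E γ).gandE2 J))
    (hc : ∀ h : C → ℝ, Monotone h → (∀ γ, 0 ≤ h γ) → ∀ J : ℤ, 0 ≤ ∑ γ, h γ * (E γ).gandCon J)
    {H0 H1 : Bool × C → ℝ} (m0 : Monotone H0) (m1 : Monotone H1) (n0 : ∀ p, 0 ≤ H0 p) (le : ∀ p, H0 p ≤ H1 p) (J : ℤ) :
    0 ≤ ∑ p, (H1 p * (parE E p).gandE1 J + H0 p * (parE E p).gandE2 J) := by
  rw [sum_bool_prod]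
  simp only [parE, EDat.gandE1_par_true, EDat.gandE1_par_false, EDat.gandE2_par_true, EDat.gandE2_par_false]
  have : ∑ γ, (H1 (true, γ) * (E γ).gandE1 (J - 1) + H0 (true, γ) * (E γ).gandCon J)
      + ∑ γ, (H1 (false, γ) * (E γ).gandCon J + H0 (false, γ) * (E γ).gandE2 (J - 1))
      = ∑ γ, (H1 (true, γ) * (E γ).gandE1 (J - 1) + H0 (false, γ) * (E γ).gandE2 (J - 1))
        + ∑ γ, (H0 (true, γ) + H1 (false, γ)) * (E γ).gandCon J := by
    rw [← Finset.sum_add_distrib, ← Finset.sum_add_distrib]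
    exact Finset.sum_congr rfl fun γ _ => by ring
  rw [this]
  exact add_nonneg (hf _ _ (mono_sec m0 false) (mono_sec m1 true) (fun γ => n0 _)
    (fun γ => (sec_le m0 γ).trans (le _)) _)
    (hc _ ((mono_sec m0 true).add (mono_sec m1 false)) (fun γ => add_nonneg (n0 _) ((n0 _).trans (le _))) J)

end Steps

section Words

variable {C : Type} [Fintype C] [Preorder C]

/-- The spine environment of a word over a pattern-indexed base environment (`ℓ₁` outermost). [folklore] -/
def spine (E : Env ι C) : (W : List Letter) → Env ι (SpCfg C W)
  | [] => E
  | Letter.ser :: W => serE (spine E W)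
  | Letter.par :: W => parE (spine E W)

/-- **The word theorem for any number of specials.**  The five facts propagate from the base environment to every spine environment
`ℓ₁(⋯ℓ_m(E)⋯)`. [folklore] -/
theorem gspine_facts (E : Env ι C)
    (hM : ∀ h0 h1 : C → ℝ, Monotone h0 → Monotone h1 → (∀ γ, 0 ≤ h0 γ) → (∀ γ, h0 γ ≤ h1 γ) → ∀ J : ℤ, 0 ≤ gMt E h0 h1 J)
    (hP : ∀ h0 h1 : Bool × C → ℝ, Monotone h0 → Monotone h1 → (∀ p, 0 ≤ h0 p) → (∀ p, h0 p ≤ h1 p) → ∀ J : ℤ,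
      0 ≤ gMt (parE E) h0 h1 J)
    (hd : ∀ h : C → ℝ, Monotone h → (∀ γ, 0 ≤ h γ) → ∀ J : ℤ, 0 ≤ ∑ γ, h γ * (E γ).gandDel J)
    (hc : ∀ h : C → ℝ, Monotone h → (∀ γ, 0 ≤ h γ) → ∀ J : ℤ, 0 ≤ ∑ γ, h γ * (E γ).gandCon J)
    (hf : ∀ h0 h1 : C → ℝ, Monotone h0 → Monotone h1 → (∀ γ, 0 ≤ h0 γ) → (∀ γ, h0 γ ≤ h1 γ) → ∀ J : ℤ,
      0 ≤ ∑ γ, (h1 γ * (E γ).gandE1 J + h0 γ * (E γ).gandE2 J))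
    (W : List Letter) :
    (∀ h0 h1 : SpCfg C W → ℝ, Monotone h0 → Monotone h1 → (∀ γ, 0 ≤ h0 γ) → (∀ γ, h0 γ ≤ h1 γ) → ∀ J : ℤ,
        0 ≤ gMt (spine E W) h0 h1 J)
    ∧ (∀ h0 h1 : Bool × SpCfg C W → ℝ, Monotone h0 → Monotone h1 → (∀ p, 0 ≤ h0 p) → (∀ p, h0 p ≤ h1 p) → ∀ J : ℤ,
        0 ≤ gMt (parE (spine E W)) h0 h1 J)
    ∧ (∀ h : SpCfg C W → ℝ, Monotone h → (∀ γ, 0 ≤ h γ) → ∀ J : ℤ, 0 ≤ ∑ γ, h γ * (spine E W γ).gandDel J)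
    ∧ (∀ h : SpCfg C W → ℝ, Monotone h → (∀ γ, 0 ≤ h γ) → ∀ J : ℤ, 0 ≤ ∑ γ, h γ * (spine E W γ).gandCon J)
    ∧ (∀ h0 h1 : SpCfg C W → ℝ, Monotone h0 → Monotone h1 → (∀ γ, 0 ≤ h0 γ) → (∀ γ, h0 γ ≤ h1 γ) → ∀ J : ℤ,
        0 ≤ ∑ γ, (h1 γ * (spine E W γ).gandE1 J + h0 γ * (spine E W γ).gandE2 J)) := by
  induction W with
  | nil => exact ⟨hM, hP, hd, hc, hf⟩
  | cons l W ih =>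
    obtain ⟨iM, iP, id, ic, iF⟩ := ih
    cases l with
    | ser =>
      refine ⟨?_, ?_, ?_, ?_, ?_⟩
      · exact fun h0 h1 m0 m1 n0 le J => gMt_ser_nonneg iM id m0 m1 n0 le J
      · exact fun h0 h1 m0 m1 n0 le J => gMt_par_ser_nonneg iM id iF m0 m1 n0 le J
      · exact fun h m n J => gandDel_ser_nonneg id m n J
      · exact fun h m n J => gandCon_ser_nonneg iF m n J
      · exact fun h0 h1 m0 m1 n0 le J => gandFree_ser_nonneg iF id m0 m1 n0 le J
    | par =>
      refine ⟨?_, ?_, ?_, ?_, ?_⟩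
      · exact fun h0 h1 m0 m1 n0 le J => iP h0 h1 m0 m1 n0 le J
      · exact fun h0 h1 m0 m1 n0 le J => gMt_par_par_nonneg iP ic m0 m1 n0 le J
      · exact fun h m n J => gandDel_par_nonneg iF m n J
      · exact fun h m n J => gandCon_par_nonneg ic m n J
      · exact fun h0 h1 m0 m1 n0 le J => gandFree_par_nonneg iF ic m0 m1 n0 le J

/-- **★ in root form for every spine word and any number of specials**: under the five base facts, the un-nested root functional of every
spine environment is nonnegative against every monotone nonnegative weight. [folklore] -/
theorem gspine_root_nonneg (E : Env ι C)
    (hM : ∀ h0 h1 : C → ℝ, Monotone h0 → Monotone h1 → (∀ γ, 0 ≤ h0 γ) → (∀ γ, h0 γ ≤ h1 γ) → ∀ J : ℤ, 0 ≤ gMt E h0 h1 J)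
    (hP : ∀ h0 h1 : Bool × C → ℝ, Monotone h0 → Monotone h1 → (∀ p, 0 ≤ h0 p) → (∀ p, h0 p ≤ h1 p) → ∀ J : ℤ,
      0 ≤ gMt (parE E) h0 h1 J)
    (hd : ∀ h : C → ℝ, Monotone h → (∀ γ, 0 ≤ h γ) → ∀ J : ℤ, 0 ≤ ∑ γ, h γ * (E γ).gandDel J)
    (hc : ∀ h : C → ℝ, Monotone h → (∀ γ, 0 ≤ h γ) → ∀ J : ℤ, 0 ≤ ∑ γ, h γ * (E γ).gandCon J)
    (hf : ∀ h0 h1 : C → ℝ, Monotone h0 → Monotone h1 → (∀ γ, 0 ≤ h0 γ) → (∀ γ, h0 γ ≤ h1 γ) → ∀ J : ℤ,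
      0 ≤ ∑ γ, (h1 γ * (E γ).gandE1 J + h0 γ * (E γ).gandE2 J))
    (W : List Letter) (h : SpCfg C W → ℝ) (hm : Monotone h) (hn : ∀ γ, 0 ≤ h γ) (J : ℤ) :
    0 ≤ gMt (spine E W) h h J :=
  (gspine_facts E hM hP hd hc hf W).1 h h hm hm hn (fun _ => le_rfl) J

end Words

end Gen

end RootForm

end FK

end Summit.CriticalPhenomena.PercolationContinuityZ3.Theorems

end
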